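import Summits.RiemannHypothesis.RiemannHypothesis.Theses.WeilComb
import Summits.RiemannHypothesis.RiemannHypothesis.Theorems.WeilCombCombShapeDetection
import Summits.RiemannHypothesis.RiemannHypothesis.Theorems.WeilCombCombShapeAdmissible
import Summits.RiemannHypothesis.RiemannHypothesis.Theorems.WeilCombCombShapePositivityStubBumpTransform
import Summits.RiemannHypothesis.RiemannHypothesis.Theorems.WeilCombCombShapePositivityStubLaplaceCauchyKernel
import Literature.NumberTheory.LFunctions.WeilCriterionConverse
import Literature.NumberTheory.LFunctions.WeilExplicitFormulaProofs
import Literature.NumberTheory.LFunctions.WeilExplicitProofs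
import Literature.NumberTheory.LFunctions.WeilMellinBounds
import Literature.NumberTheory.LFunctions.WeilMellinInversion
import Literature.NumberTheory.LFunctions.WeilDilationVirial
import Literature.NumberTheory.LFunctions.WeilZeroSum
import Literature.NumberTheory.LFunctions.LandauOscillation
import Mathlib

/-!
# Dilation detection I — the zero-side series of the diagonal and its Laplace transform

stub-plan `Cruxes/CombShapePositivity/STUB-PLAN-stub_fejer.md`, tier ★T2 DILATION DETECTION
(crux `WeilComb.CombShapePositivity`, item stmt-RiemannHypothesis-11229, route route-RiemannHypothesis-WeilComb,
line `Sketch`; sprove seat). The five files `…StubDilationSeries` → `…KernelSum` → `…Landau` → `…Geometry` →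
`…Detection` prove `stub_dilationDetection : (∀ ε ≥ 1, 0 ≤ Re W(φ_ε ⋆ φ̃_ε)) → RiemannHypothesis`
(a theorem ABOUT the RH-equivalent stub `stub_fejer` — its `S = ∅` face is already RH-complete — not a step
of `CombShapePositivity_of`).

This file: with `φ_ε(t) = ε⁻¹ φ₀(t/ε)`, `φ₀(u) = expNegInvGlue (1 − u²)`, `Φ₀(z) = ∫ φ₀(u) e^{zu} du`
(entire), `ψ₀ = φ₀ ⋆ φ₀` and the Cauchy–Laplace kernel `K(w, s) = ∫_{-2}^2 ψ₀(t) e^{wt−s}/(s − wt) dt`: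
* `pairCoeff_bump_eq_sq`: `P_{φ_ε}(ρ) = Φ₀(ε(ρ − ½))²` (a SQUARE — `φ₀` real and even);
* `weilQuadratic_bump_eq_tsum`: `Q(φ_ε) = Σ_ρ m(ρ) Φ₀(ε(ρ − ½))²`;
* `norm_weilQuadratic_bump_le`: `‖Q(φ_ε)‖ ≤ C₁ e^ε` (`ε ≥ 1`); reality; continuity on `[1, ∞)`;
* `laplace_weilQuadratic_bump` (registered as `diag_laplace_zeroKernelSum`): for `Re s > 1`,
  `∫_1^∞ Q(φ_ε) e^{−sε} dε = Σ_ρ m(ρ) K(ρ − ½, s)` (termwise `laplace_cauchyKernel`, dominated interchange).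
-/

noncomputable section

-- the sub-problem path RiemannHypothesis/RiemannHypothesis duplicates a namespace (D-0017)
set_option linter.dupNamespace false

open scoped BigOperators ComplexConjugate Real Topology
open Complex MeasureTheory Set Filter

namespace Summit.RiemannHypothesis.RiemannHypothesis.Theorems.WeilCombBohrFejer

open Literature.NumberTheory.LFunctions
open Literature.NumberTheory.LFunctions.WeilConverse

/-! ## Notation (local, purely syntactic abbreviations of sub-terms of the registered stubs) -/

/-- the route bump `φ_ε(t) = ε⁻¹ φ₀(t/ε)` (verbatim sub-term of the registered stubs). -/
local notation "φb(" ε ")" =>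
  (fun t : ℝ => ((ε : ℝ) : ℂ)⁻¹ * ((expNegInvGlue (1 - (t / ε) ^ 2) : ℝ) : ℂ))

/-- the fixed bump as a complex function `φ₀ℂ(u) = expNegInvGlue (1 - u²)`. -/
local notation "φ₀ℂ" => (fun u : ℝ => ((expNegInvGlue (1 - u ^ 2) : ℝ) : ℂ))

/-- its entire transform `Φ₀(z) = ∫ φ₀(u) e^{zu} du`. -/
local notation "Φ₀(" z ")" =>
  (∫ u : ℝ, ((expNegInvGlue (1 - u ^ 2) : ℝ) : ℂ) * Complex.exp (z * u))

/-- the autocorrelation `ψ₀ = φ₀ ⋆ φ₀`. -/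
local notation "ψ₀(" t ")" =>
  (∫ u : ℝ, expNegInvGlue (1 - u ^ 2) * expNegInvGlue (1 - (t - u) ^ 2))

/-- the Cauchy–Laplace kernel of `ψ₀`: `K(w, s) = ∫_{-2}^{2} ψ₀(t) e^{wt − s}/(s − wt) dt`. -/
local notation "Kψ(" w ", " s ")" =>
  (∫ t in (-2 : ℝ)..2, (((∫ u : ℝ, expNegInvGlue (1 - u ^ 2) * expNegInvGlue (1 - (t - u) ^ 2)) : ℝ) : ℂ) *
    Complex.exp (w * t - s) / (s - w * t))

/-- the set of non-trivial zeros (subtype). -/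
local notation "𝒵" => ZetaZeros.riemannZetaNontrivialZeros

/-! ## B1 · the zero-side series of the diagonal `D(ε) = Q(φ_ε) = Σ_ρ m(ρ) Φ₀(ε(ρ − ½))²` -/

/-- `Φ₀(z) = φ̂₀(½ + z)` in the tree's normalisation `weilMellin`. [folklore] -/
theorem bumpTransform_eq_weilMellin' (z : ℂ) : Φ₀(z) = weilMellin φ₀ℂ (1 / 2 + z) := by
  unfold weilMellin
  congr 1
  funext u
  congr 2
  ring

/-- `Φ₀` is an entire function. [folklore] -/
theorem differentiable_bumpTransform : Differentiable ℂ fun z : ℂ => Φ₀(z) := by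
  have h := differentiable_weilMellin weilComb_shapeBump_isWeilTest.1.continuous
    weilComb_shapeBump_isWeilTest.2
  have e : (fun z : ℂ => Φ₀(z)) = fun z => weilMellin φ₀ℂ (1 / 2 + z) :=
    funext fun z => bumpTransform_eq_weilMellin' z
  rw [e]
  exact h.comp (differentiable_const _ |>.add differentiable_id)

/-- `Φ₀` is continuous. [folklore] -/
theorem continuous_bumpTransform : Continuous fun z : ℂ => Φ₀(z) :=
  differentiable_bumpTransform.continuous

/-- Dilation: `φ̂_ε(s) = Φ₀(ε(s − ½))` for `ε > 0` (`weilMellin_comp_mul`). [folklore] -/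
theorem weilMellin_bump {ε : ℝ} (hε : 0 < ε) (s : ℂ) :
    weilMellin φb(ε) s = Φ₀((ε : ℂ) * (s - 1 / 2)) := by
  have hε0 : (ε : ℂ) ≠ 0 := Complex.ofReal_ne_zero.2 hε.ne'
  have h1 : φb(ε) = fun t : ℝ => ((ε : ℝ) : ℂ)⁻¹ * φ₀ℂ (ε⁻¹ * t) := by
    funext t
    simp only [div_eq_inv_mul]
  rw [h1, weilMellin_const_mul, weilMellin_comp_mul φ₀ℂ (inv_pos.2 hε),
    bumpTransform_eq_weilMellin']
  have h2 : (1 / 2 + (s - 1 / 2) / ((ε⁻¹ : ℝ) : ℂ)) = 1 / 2 + (ε : ℂ) * (s - 1 / 2) := by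
    push_cast
    field_simp
  rw [h2, ← mul_assoc]
  push_cast
  rw [inv_inv, inv_mul_cancel₀ hε0, one_mul]

/-- **The pairing is a SQUARE**: `P_{φ_ε}(ρ) = Φ₀(ε(ρ − ½))²` (`φ₀` real and even, so
`conj φ̂_ε(1 − ρ̄) = φ̂_ε(ρ)`). [folklore] -/
theorem pairCoeff_bump_eq_sq {ε : ℝ} (hε : 0 < ε) (ρ : ℂ) :
    pairCoeff φb(ε) ρ = Φ₀((ε : ℂ) * (ρ - 1 / 2)) ^ 2 := by
  rw [pairCoeff, weilMellin_bump hε, weilMellin_bump hε]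
  have h1 : (ε : ℂ) * (1 - conj ρ - 1 / 2) = -conj ((ε : ℂ) * (ρ - 1 / 2)) := by
    simp only [map_mul, map_sub, Complex.conj_ofReal, map_div₀, map_one, map_ofNat]
    ring
  rw [h1, bumpTransform_neg, ← conj_bumpTransform, Complex.conj_conj, sq]

/-- **Zero-side series of the diagonal**: `Q(φ_ε) = Σ_ρ m(ρ) Φ₀(ε(ρ − ½))²`
(`combShapeDetection_zeroForm_eq_weilQuadratic` + `pairCoeff_bump_eq_sq`). [folklore] -/
theorem weilQuadratic_bump_eq_tsum {ε : ℝ} (hε : 0 < ε) :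
    weilQuadratic φb(ε) =
      ∑' ρ : 𝒵, (riemannZetaZeroOrder (ρ : ℂ) : ℂ) * Φ₀((ε : ℂ) * ((ρ : ℂ) - 1 / 2)) ^ 2 := by
  rw [← combShapeDetection_zeroForm_eq_weilQuadratic (combShapeDetection_shapeBump_isWeilTest ε),
    zeroForm]
  exact tsum_congr fun ρ => by rw [pairCoeff_bump_eq_sq hε]

/-! ## B1 · growth `‖D(ε)‖ ≤ C₁ e^{ε}` and termwise bounds -/

/-- The decay constant of `Φ₀` can be taken `≥ 0`. [folklore] -/
theorem bumpTransform_decay' : ∃ C : ℝ, 0 ≤ C ∧ ∀ z : ℂ,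
    ‖Φ₀(z)‖ ≤ C * Real.exp |z.re| / (1 + ‖z‖ ^ 2) := by
  obtain ⟨C, hC⟩ := bumpTransform_decay
  refine ⟨max C 0, le_max_right _ _, fun z => (hC z).trans ?_⟩
  exact div_le_div_of_nonneg_right
    (mul_le_mul_of_nonneg_right (le_max_left _ _) (Real.exp_pos _).le) (by positivity)

/-- Termwise bound on the zero side: for `ε ≥ 1` and a non-trivial zero `ρ`,
`‖Φ₀(ε(ρ − ½))²‖ ≤ C² e^{ε} / (1 + (Im ρ)²)²`. [folklore] -/
theorem norm_sq_bumpTransform_zero_le {C : ℝ} (hC0 : 0 ≤ C)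
    (hC : ∀ z : ℂ, ‖Φ₀(z)‖ ≤ C * Real.exp |z.re| / (1 + ‖z‖ ^ 2))
    {ε : ℝ} (hε : 1 ≤ ε) {ρ : ℂ} (hρ : ρ ∈ 𝒵) :
    ‖Φ₀((ε : ℂ) * (ρ - 1 / 2)) ^ 2‖ ≤ C ^ 2 * Real.exp ε / (1 + ρ.im ^ 2) ^ 2 := by
  have hz := hC ((ε : ℂ) * (ρ - 1 / 2))
  have hre : |((ε : ℂ) * (ρ - 1 / 2)).re| ≤ ε / 2 := by
    have h1 : ((ε : ℂ) * (ρ - 1 / 2)).re = ε * (ρ.re - 1 / 2) := by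
      simp [Complex.mul_re, sub_re]
    rw [h1, abs_mul, abs_of_pos (by linarith)]
    have h2 : |ρ.re - 1 / 2| ≤ 1 / 2 := by
      have := abs_re_sub_half_le hρ
      simpa [sub_re] using this
    nlinarith
  have hnorm : ρ.im ^ 2 ≤ ‖(ε : ℂ) * (ρ - 1 / 2)‖ ^ 2 := by
    have h1 : ((ε : ℂ) * (ρ - 1 / 2)).im = ε * ρ.im := by simp [Complex.mul_im, sub_im]
    have h2 : |((ε : ℂ) * (ρ - 1 / 2)).im| ≤ ‖(ε : ℂ) * (ρ - 1 / 2)‖ := abs_im_le_norm _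
    have h3 : |ρ.im| ≤ |ε * ρ.im| := by
      rw [abs_mul, abs_of_pos (show (0 : ℝ) < ε by linarith)]
      exact le_mul_of_one_le_left (abs_nonneg _) hε
    rw [h1] at h2
    have h4 : |ρ.im| ≤ ‖(ε : ℂ) * (ρ - 1 / 2)‖ := h3.trans h2
    nlinarith [abs_nonneg ρ.im, sq_abs ρ.im]
  have hden : (1 + ρ.im ^ 2) ≤ 1 + ‖(ε : ℂ) * (ρ - 1 / 2)‖ ^ 2 := by linarith
  have hexp : Real.exp |((ε : ℂ) * (ρ - 1 / 2)).re| ≤ Real.exp (ε / 2) := Real.exp_le_exp.2 hre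
  have hΦ : ‖Φ₀((ε : ℂ) * (ρ - 1 / 2))‖ ≤ C * Real.exp (ε / 2) / (1 + ρ.im ^ 2) := by
    refine hz.trans ?_
    have hpos : 0 < 1 + ρ.im ^ 2 := by positivity
    calc C * Real.exp |((ε : ℂ) * (ρ - 1 / 2)).re| / (1 + ‖(ε : ℂ) * (ρ - 1 / 2)‖ ^ 2)
        ≤ C * Real.exp (ε / 2) / (1 + ‖(ε : ℂ) * (ρ - 1 / 2)‖ ^ 2) := by gcongr
      _ ≤ C * Real.exp (ε / 2) / (1 + ρ.im ^ 2) :=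
          div_le_div_of_nonneg_left (by positivity) hpos hden
  rw [norm_pow]
  have h0 : 0 ≤ ‖Φ₀((ε : ℂ) * (ρ - 1 / 2))‖ := norm_nonneg _
  calc ‖Φ₀((ε : ℂ) * (ρ - 1 / 2))‖ ^ 2 ≤ (C * Real.exp (ε / 2) / (1 + ρ.im ^ 2)) ^ 2 :=
        pow_le_pow_left₀ h0 hΦ 2
    _ = C ^ 2 * Real.exp ε / (1 + ρ.im ^ 2) ^ 2 := by
        rw [div_pow, mul_pow, sq (Real.exp _), ← Real.exp_add, add_halves]

/-- **Growth of the diagonal**: `‖Q(φ_ε)‖ ≤ C₁ e^{ε}` for `ε ≥ 1`. [folklore] -/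
theorem norm_weilQuadratic_bump_le : ∃ C₁ : ℝ, 0 ≤ C₁ ∧ ∀ ε : ℝ, 1 ≤ ε →
    ‖weilQuadratic φb(ε)‖ ≤ C₁ * Real.exp ε := by
  obtain ⟨C, hC0, hC⟩ := bumpTransform_decay'
  set Z₀ : ℝ := ∑' ρ : 𝒵, weilZeroWeight (ρ : ℂ) with hZ₀
  have hZ₀nn : 0 ≤ Z₀ := tsum_nonneg fun ρ => weilZeroWeight_nonneg ρ.2
  refine ⟨C ^ 2 * Z₀, by positivity, fun ε hε => ?_⟩
  have hε0 : 0 < ε := by linarith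
  rw [weilQuadratic_bump_eq_tsum hε0]
  have hb : ∀ ρ : 𝒵, ‖(riemannZetaZeroOrder (ρ : ℂ) : ℂ) * Φ₀((ε : ℂ) * ((ρ : ℂ) - 1 / 2)) ^ 2‖ ≤
      C ^ 2 * Real.exp ε * weilZeroWeight (ρ : ℂ) := by
    intro ρ
    have hm : (0 : ℝ) ≤ riemannZetaZeroOrder (ρ : ℂ) := by
      exact_mod_cast riemannZetaZeroOrder_nonneg (ZetaZeros.riemannZetaNontrivialZeros.ne_one ρ.2)
    rw [norm_mul, Complex.norm_intCast, abs_of_nonneg hm, weilZeroWeight]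
    calc (riemannZetaZeroOrder (ρ : ℂ) : ℝ) * ‖Φ₀((ε : ℂ) * ((ρ : ℂ) - 1 / 2)) ^ 2‖
        ≤ (riemannZetaZeroOrder (ρ : ℂ) : ℝ) * (C ^ 2 * Real.exp ε / (1 + (ρ : ℂ).im ^ 2) ^ 2) :=
          mul_le_mul_of_nonneg_left (norm_sq_bumpTransform_zero_le hC0 hC hε ρ.2) hm
      _ = C ^ 2 * Real.exp ε * ((riemannZetaZeroOrder (ρ : ℂ) : ℝ) / (1 + (ρ : ℂ).im ^ 2) ^ 2) := by
          ring
  have hs : Summable fun ρ : 𝒵 => C ^ 2 * Real.exp ε * weilZeroWeight (ρ : ℂ) :=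
    weilZeroSummable.mul_left _
  calc ‖∑' ρ : 𝒵, (riemannZetaZeroOrder (ρ : ℂ) : ℂ) * Φ₀((ε : ℂ) * ((ρ : ℂ) - 1 / 2)) ^ 2‖
      ≤ ∑' ρ : 𝒵, ‖(riemannZetaZeroOrder (ρ : ℂ) : ℂ) * Φ₀((ε : ℂ) * ((ρ : ℂ) - 1 / 2)) ^ 2‖ :=
        norm_tsum_le_tsum_norm (Summable.of_nonneg_of_le (fun _ => norm_nonneg _) hb hs)
    _ ≤ ∑' ρ : 𝒵, C ^ 2 * Real.exp ε * weilZeroWeight (ρ : ℂ) :=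
        Summable.tsum_le_tsum hb (Summable.of_nonneg_of_le (fun _ => norm_nonneg _) hb hs) hs
    _ = C ^ 2 * Z₀ * Real.exp ε := by rw [tsum_mul_left, hZ₀]; ring

/-! ## B1 · reality and continuity of the diagonal on `[1, ∞)` -/

/-- `Q(φ_ε)` is real (`weilQuadratic_im_holds`). [folklore] -/
theorem weilQuadratic_bump_im (ε : ℝ) : (weilQuadratic φb(ε)).im = 0 :=
  weilQuadratic_im_holds (combShapeDetection_shapeBump_isWeilTest ε)

/-- `Q(φ_ε) = Re Q(φ_ε)` as a complex number. [folklore] -/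
theorem weilQuadratic_bump_eq_re (ε : ℝ) :
    weilQuadratic φb(ε) = (((weilQuadratic φb(ε)).re : ℝ) : ℂ) := by
  apply Complex.ext
  · simp
  · simp [weilQuadratic_bump_im ε]

/-- The diagonal `ε ↦ Q(φ_ε)` is continuous on every `[1, R]` (locally uniform convergence of the
zero-side series). [folklore] -/
theorem continuousOn_weilQuadratic_bump_Icc (R : ℝ) :
    ContinuousOn (fun ε : ℝ => weilQuadratic φb(ε)) (Icc 1 R) := by
  obtain ⟨C, hC0, hC⟩ := bumpTransform_decay'
  have hcongr : ∀ ε ∈ Icc (1 : ℝ) R, weilQuadratic φb(ε) =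
      ∑' ρ : 𝒵, (riemannZetaZeroOrder (ρ : ℂ) : ℂ) * Φ₀((ε : ℂ) * ((ρ : ℂ) - 1 / 2)) ^ 2 :=
    fun ε hε => weilQuadratic_bump_eq_tsum (by linarith [hε.1])
  refine ContinuousOn.congr ?_ hcongr
  refine continuousOn_tsum (u := fun ρ : 𝒵 => C ^ 2 * Real.exp R * weilZeroWeight (ρ : ℂ))
    (fun ρ => ?_) (weilZeroSummable.mul_left _) (fun ρ ε hε => ?_)
  · refine Continuous.continuousOn ?_
    refine continuous_const.mul ((continuous_bumpTransform.comp ?_).pow 2)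
    exact Complex.continuous_ofReal.mul continuous_const
  · have hm : (0 : ℝ) ≤ riemannZetaZeroOrder (ρ : ℂ) := by
      exact_mod_cast riemannZetaZeroOrder_nonneg (ZetaZeros.riemannZetaNontrivialZeros.ne_one ρ.2)
    rw [norm_mul, Complex.norm_intCast, abs_of_nonneg hm, weilZeroWeight]
    have hb := norm_sq_bumpTransform_zero_le hC0 hC hε.1 ρ.2
    have hR : Real.exp ε ≤ Real.exp R := Real.exp_le_exp.2 hε.2
    calc (riemannZetaZeroOrder (ρ : ℂ) : ℝ) * ‖Φ₀((ε : ℂ) * ((ρ : ℂ) - 1 / 2)) ^ 2‖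
        ≤ (riemannZetaZeroOrder (ρ : ℂ) : ℝ) * (C ^ 2 * Real.exp R / (1 + (ρ : ℂ).im ^ 2) ^ 2) := by
          refine mul_le_mul_of_nonneg_left (hb.trans ?_) hm
          gcongr
      _ = C ^ 2 * Real.exp R * ((riemannZetaZeroOrder (ρ : ℂ) : ℝ) / (1 + (ρ : ℂ).im ^ 2) ^ 2) := by
          ring

/-- The diagonal is continuous on `[1, ∞)`. [folklore] -/
theorem continuousOn_weilQuadratic_bump :
    ContinuousOn (fun ε : ℝ => weilQuadratic φb(ε)) (Ici 1) := by
  intro x hx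
  have h := (continuousOn_weilQuadratic_bump_Icc (x + 1)) x ⟨hx, by linarith⟩
  refine h.mono_of_mem_nhdsWithin ?_
  have : Icc 1 (x + 1) = Ici 1 ∩ Iic (x + 1) := (Ici_inter_Iic).symm
  rw [this]
  exact inter_mem_nhdsWithin _ (Iic_mem_nhds (by linarith))

/-! ## B1 · Laplace transforms in the dilation variable -/

/-- Termwise Laplace transform with its closed form: for `Re s > 2|Re w|`,
`∫_1^∞ Φ₀(εw)² e^{−sε} dε = K(w, s)` (`bumpTransform_sq_eq` + `laplace_cauchyKernel`). [folklore] -/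
theorem laplace_sq_bumpTransform {w s : ℂ} (h : 2 * |w.re| < s.re) :
    ∫ ε in Ioi (1 : ℝ), Φ₀((ε : ℂ) * w) ^ 2 * Complex.exp (-(s * ε)) = Kψ(w, s) := by
  have hc : Continuous fun t : ℝ => ((ψ₀(t) : ℝ) : ℂ) :=
    Complex.continuous_ofReal.comp continuous_bumpAutocorr
  rw [← laplace_cauchyKernel _ hc w s h]
  refine setIntegral_congr_fun measurableSet_Ioi fun ε _ => ?_
  rw [bumpTransform_sq_eq]

/-- On a non-trivial zero `ρ`, `2|Re(ρ − ½)| < 1`. [folklore] -/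
theorem two_mul_abs_re_sub_half_lt_one {ρ : ℂ} (hρ : ρ ∈ 𝒵) : 2 * |(ρ - 1 / 2).re| < 1 := by
  have h0 := ZetaZeros.riemannZetaNontrivialZeros.re_pos hρ
  have h1 := ZetaZeros.riemannZetaNontrivialZeros.re_lt_one hρ
  have : |(ρ - 1 / 2).re| < 1 / 2 := by
    rw [abs_lt]
    constructor <;> · simp; linarith
  linarith

/-- Integrable bound for the terms of the Laplace integrand on `(1, ∞)`: for `Re s > 1`,
`‖m(ρ) Φ₀(ε(ρ−½))² e^{−sε}‖ ≤ (C² m(ρ)/(1+γ²)²) e^{−(Re s − 1) ε}`. [folklore] -/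
theorem norm_laplace_term_le {C : ℝ} (hC0 : 0 ≤ C)
    (hC : ∀ z : ℂ, ‖Φ₀(z)‖ ≤ C * Real.exp |z.re| / (1 + ‖z‖ ^ 2))
    (s : ℂ) (ρ : 𝒵) {ε : ℝ} (hε : 1 ≤ ε) :
    ‖(riemannZetaZeroOrder (ρ : ℂ) : ℂ) * (Φ₀((ε : ℂ) * ((ρ : ℂ) - 1 / 2)) ^ 2 *
        Complex.exp (-(s * ε)))‖ ≤
      C ^ 2 * weilZeroWeight (ρ : ℂ) * Real.exp (-(s.re - 1) * ε) := by
  have hm : (0 : ℝ) ≤ riemannZetaZeroOrder (ρ : ℂ) := by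
    exact_mod_cast riemannZetaZeroOrder_nonneg (ZetaZeros.riemannZetaNontrivialZeros.ne_one ρ.2)
  have hb := norm_sq_bumpTransform_zero_le hC0 hC hε ρ.2
  rw [norm_mul, norm_mul, Complex.norm_intCast, abs_of_nonneg hm, Complex.norm_exp, weilZeroWeight]
  have hre : (-(s * (ε : ℂ))).re = -(s.re * ε) := by simp [Complex.mul_re]
  rw [hre]
  have hexp : Real.exp ε * Real.exp (-(s.re * ε)) = Real.exp (-(s.re - 1) * ε) := by
    rw [← Real.exp_add]; ring_nf
  calc (riemannZetaZeroOrder (ρ : ℂ) : ℝ) * (‖Φ₀((ε : ℂ) * ((ρ : ℂ) - 1 / 2)) ^ 2‖ *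
        Real.exp (-(s.re * ε)))
      ≤ (riemannZetaZeroOrder (ρ : ℂ) : ℝ) * (C ^ 2 * Real.exp ε / (1 + (ρ : ℂ).im ^ 2) ^ 2 *
        Real.exp (-(s.re * ε))) := by
        refine mul_le_mul_of_nonneg_left ?_ hm
        exact mul_le_mul_of_nonneg_right hb (Real.exp_pos _).le
    _ = C ^ 2 * ((riemannZetaZeroOrder (ρ : ℂ) : ℝ) / (1 + (ρ : ℂ).im ^ 2) ^ 2) *
        (Real.exp ε * Real.exp (-(s.re * ε))) := by ring
    _ = _ := by rw [hexp]

/-- **Laplace transform of the diagonal = zero sum of the kernels**: for `Re s > 1`,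
`∫_1^∞ Q(φ_ε) e^{−sε} dε = Σ_ρ m(ρ) K(ρ − ½, s)` (termwise transform, dominated interchange).
[folklore] -/
theorem laplace_weilQuadratic_bump {s : ℂ} (hs : 1 < s.re) :
    ∫ ε in Ioi (1 : ℝ), weilQuadratic φb(ε) * Complex.exp (-(s * ε)) =
      ∑' ρ : 𝒵, (riemannZetaZeroOrder (ρ : ℂ) : ℂ) * Kψ((ρ : ℂ) - 1 / 2, s) := by
  obtain ⟨C, hC0, hC⟩ := bumpTransform_decay'
  -- the terms
  set F : 𝒵 → ℝ → ℂ := fun ρ ε => (riemannZetaZeroOrder (ρ : ℂ) : ℂ) *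
    (Φ₀((ε : ℂ) * ((ρ : ℂ) - 1 / 2)) ^ 2 * Complex.exp (-(s * ε))) with hF
  have hcongr : ∀ ε ∈ Ioi (1 : ℝ), weilQuadratic φb(ε) * Complex.exp (-(s * ε)) = ∑' ρ : 𝒵, F ρ ε := by
    intro ε hε
    have hε0 : 0 < ε := lt_trans one_pos hε
    rw [weilQuadratic_bump_eq_tsum hε0, ← tsum_mul_right]
    refine tsum_congr fun ρ => ?_
    simp only [hF]
    ring
  rw [setIntegral_congr_fun measurableSet_Ioi hcongr]
  -- integrability and summability of the norms
  have hσ : 0 < s.re - 1 := by linarith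
  have hFcont : ∀ ρ : 𝒵, Continuous (F ρ) := fun ρ => by
    simp only [hF]
    refine continuous_const.mul (((continuous_bumpTransform.comp ?_).pow 2).mul ?_)
    · exact Complex.continuous_ofReal.mul continuous_const
    · exact Complex.continuous_exp.comp ((continuous_const.mul Complex.continuous_ofReal).neg)
  have hbound : ∀ ρ : 𝒵, ∀ ε ∈ Ioi (1 : ℝ),
      ‖F ρ ε‖ ≤ C ^ 2 * weilZeroWeight (ρ : ℂ) * Real.exp (-(s.re - 1) * ε) :=
    fun ρ ε hε => norm_laplace_term_le hC0 hC s ρ (le_of_lt hε)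
  have hGint : ∀ ρ : 𝒵, IntegrableOn
      (fun ε : ℝ => C ^ 2 * weilZeroWeight (ρ : ℂ) * Real.exp (-(s.re - 1) * ε)) (Ioi 1) :=
    fun ρ => ((exp_neg_integrableOn_Ioi 1 hσ).const_mul _)
  have hFint : ∀ ρ : 𝒵, IntegrableOn (F ρ) (Ioi 1) := fun ρ =>
    Integrable.mono' (hGint ρ) (hFcont ρ).aestronglyMeasurable
      ((ae_restrict_iff' measurableSet_Ioi).2 (Eventually.of_forall (hbound ρ)))
  have hInorm : ∀ ρ : 𝒵, ∫ ε in Ioi (1 : ℝ), ‖F ρ ε‖ ≤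
      C ^ 2 * weilZeroWeight (ρ : ℂ) * (Real.exp (-(s.re - 1)) / (s.re - 1)) := by
    intro ρ
    have h1 : ∫ ε in Ioi (1 : ℝ), ‖F ρ ε‖ ≤
        ∫ ε in Ioi (1 : ℝ), C ^ 2 * weilZeroWeight (ρ : ℂ) * Real.exp (-(s.re - 1) * ε) :=
      setIntegral_mono_on (hFint ρ).norm (hGint ρ) measurableSet_Ioi (hbound ρ)
    refine h1.trans (le_of_eq ?_)
    rw [integral_const_mul, integral_exp_mul_Ioi (by linarith) 1]
    congr 1
    field_simp
  have hsum : Summable fun ρ : 𝒵 => ∫ ε in Ioi (1 : ℝ), ‖F ρ ε‖ := by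
    refine Summable.of_nonneg_of_le (fun ρ => integral_nonneg fun _ => norm_nonneg _) hInorm ?_
    exact (weilZeroSummable.mul_left (C ^ 2)).mul_right _
  rw [← integral_tsum_of_summable_integral_norm hFint hsum]
  refine tsum_congr fun ρ => ?_
  simp only [hF]
  rw [integral_const_mul, laplace_sq_bumpTransform]
  exact lt_trans (two_mul_abs_re_sub_half_lt_one ρ.2) hs

/-- **Registered form `diag_laplace_zeroKernelSum`** (crux stmt-RiemannHypothesis-11229, T2 component):
the Laplace transform of the diagonal is the zero sum of kernels, `Re s > 1`. [folklore] -/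
theorem diag_laplace_zeroKernelSum :
    ∀ s : ℂ, 1 < s.re → ∫ ε in Set.Ioi (1 : ℝ), weilQuadratic (fun t : ℝ => ((ε : ℝ) : ℂ)⁻¹ *
    ((expNegInvGlue (1 - (t / ε) ^ 2) : ℝ) : ℂ)) * Complex.exp (-(s * ε)) = ∑' ρ :
    ZetaZeros.riemannZetaNontrivialZeros, (riemannZetaZeroOrder (ρ : ℂ) : ℂ) * (∫ t in (-2 : ℝ)..2,
    (((∫ u : ℝ, expNegInvGlue (1 - u ^ 2) * expNegInvGlue (1 - (t - u) ^ 2)) : ℝ) : ℂ) * Complex.exp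
    (((ρ : ℂ) - 1 / 2) * t - s) / (s - ((ρ : ℂ) - 1 / 2) * t)) :=
  fun _ hs => laplace_weilQuadratic_bump hs

end Summit.RiemannHypothesis.RiemannHypothesis.Theorems.WeilCombBohrFejer

end
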